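import Summits.NavierStokesRegularity.NavierStokesRegularity.Theorems.ScenarioCensusRowF1ax
import Summits.NavierStokesRegularity.NavierStokesRegularity.Theorems.LocalSineTubeDoorProfileAlignedWindowRigidityAncient
import HarnessLib

/-!
# Census row F1, family «CAGE» (F1cg ⊆ F1scg ⊆ F1sl ⊆ F1po) — LINE «caged-top» port, part 1/2: the cages, the rows, the floor SOLID TOP,
# the residual `TopCaging` (≡ Row_F1), analytic slices and the singular Type-I zoom package

Re-homed for the scenario census (typer seat ns-census-typer-1 g7; the cells F1cg ⊆ F1scg ⊆ F1sl ⊆ F1po are MEMBERS OF RECORD «DECIDED IN KERNEL IN FILES» of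
row F1 since census v1.68 (critic idea-crit-3 PASS 18:50:08Z; ref ns-census-ref g8 PRE-CHECK ✓ §13.14 [2/6]: rev2 9b156507 = 43/43 decls identical to
47e154239c1ce73f; lit §21.20); this port makes them TREE-decided): VERBATIM PORT of ns-idea-3 LINE 14 «caged-top»,
`pub/ideators/ns-idea-3/lines/caged-top/line-caged-top.lean` sha16 9b156507ba7cf0a9 (628 l., lean check rc 0, 0 sorry), split for the 400-line rule
into `ScenarioCensusRowF1Caged` (§1–§2) → `ScenarioCensusRowF1CagedTop` (§3–§4 + census KEYS).  Lean text VERBATIM in namespace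
`…Theorems.ScenarioCensus.CagedTop` (the line's `…Cruxes.ScenarioCensusRowF1.CagedTopLine` re-homed); port edits: `@[conjecture]` on the residual
`TopCaging` (≡ `ScenarioCensus.Row_F1`, OPEN; obligation node), nothing else.

No census VALUE is moved here (row F1 stays OPEN-WITH-LINE; the members become TREE-decided by name); NS regularity is NOT proved; `Row_F1` is
untouched (zero movement, `topCaging_iff_rowF1`); no summit statement is proved by this file.
-/

-- the summit and its single problem share the name `NavierStokesRegularity` (D-0017 nested layout)
set_option linter.dupNamespace false

noncomputable section

open MeasureTheory Set Function Filter TopologicalSpace Metric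
open scoped Topology NNReal ENNReal InnerProductSpace RealInnerProductSpace

namespace Summit.NavierStokesRegularity.NavierStokesRegularity.Theorems.ScenarioCensus.CagedTop

open Literature.Analysis Literature.Analysis.FluidPDE
open Summit.NavierStokesRegularity.NavierStokesRegularity.Theorems
open Summit.NavierStokesRegularity.NavierStokesRegularity.Theorems.LocalSineTubeDoorProfileAlignedWindowRigidityAncient
  (analyticOnNhd_slice bdd_of_hasTypeITimeDecay)

/-- `ℝ³`. -/
abbrev E3 := EuclideanSpace ℝ (Fin 3)

/-! ## §1 The cages (ball ⊆ slab ⊆ porous), the rows, the floor, the residual, the split of `Row_F1` -/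

/-- **Caged top at the (moving) level `Λ` with constant `A`**: eventually as `t ↑ T`, any two points
where the speed exceeds `Λ t` are at distance at most `A √(ν (T − t))` — the `Λ`-fast fluid sits in one
parabolic ball (diameter form: no centre is named, the cage may wander). -/
def HasCagedTopAt (ν T : ℝ) (Λ : ℝ → ℝ) (A : ℝ) (u : ℝ → E3 → E3) : Prop :=
  ∀ᶠ t in 𝓝[<] T, ∀ x x' : E3, Λ t < ‖u t x‖ → Λ t < ‖u t x'‖ →
    ‖x - x'‖ ≤ A * Real.sqrt (ν * (T - t))

/-- **Slab-caged top at the (moving) level `Λ` with constant `A`**: eventually as `t ↑ T` there is a unit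
direction `e = e(t)` such that any two points where the speed exceeds `Λ t` have `|⟪x − x', e⟫| ≤ A √(ν (T − t))`
— the `Λ`-fast fluid fits between two parallel planes at parabolic distance (normal free to rotate in time):
point-, filament- and sheet-like tops are all slab-caged. -/
def HasSlabCagedTopAt (ν T : ℝ) (Λ : ℝ → ℝ) (A : ℝ) (u : ℝ → E3 → E3) : Prop :=
  ∀ᶠ t in 𝓝[<] T, ∃ e : E3, ‖e‖ = 1 ∧ ∀ x x' : E3, Λ t < ‖u t x‖ → Λ t < ‖u t x'‖ →
    |⟪x - x', e⟫| ≤ A * Real.sqrt (ν * (T - t))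

/-- **Porous top at the (moving) level `Λ` with constants `A`, `a`**: eventually as `t ↑ T`, every point
where the speed exceeds `Λ t` has, within distance `A √(ν (T − t))`, the centre of a ball of radius
`a √(ν (T − t))` on which the speed is `≤ Λ t` — near every fast point there is a parabolic PORE free of fast
fluid.  The weakest of the three cages. -/
def HasPorousTopAt (ν T : ℝ) (Λ : ℝ → ℝ) (A a : ℝ) (u : ℝ → E3 → E3) : Prop :=
  ∀ᶠ t in 𝓝[<] T, ∀ x : E3, Λ t < ‖u t x‖ → ∃ z : E3, ‖z - x‖ ≤ A * Real.sqrt (ν * (T - t)) ∧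
    ∀ x' : E3, ‖x' - z‖ < a * Real.sqrt (ν * (T - t)) → ‖u t x'‖ ≤ Λ t

/-- **Subcritical level**: `Λ(t) √(T − t) → 0` as `t ↑ T` (constant levels, `(T−t)^{-1/4}`, … ; NOT the
Type-I scale `(T−t)^{-1/2}`). -/
def IsSubcriticalLevel (T : ℝ) (Λ : ℝ → ℝ) : Prop :=
  Tendsto (fun t => Λ t * Real.sqrt (T - t)) (𝓝[<] T) (𝓝 0)

/-- **Caged top** (constant level): some speed level `Λ` and some `A` cage the top in a ball. -/
def HasCagedTop (ν T : ℝ) (u : ℝ → E3 → E3) : Prop :=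
  ∃ Λ A : ℝ, HasCagedTopAt ν T (fun _ => Λ) A u

/-- **Subcritically caged top**: some subcritical moving level `Λ(t)` and some `A` cage the top in a ball. -/
def HasSubcriticallyCagedTop (ν T : ℝ) (u : ℝ → E3 → E3) : Prop :=
  ∃ (Λ : ℝ → ℝ) (A : ℝ), IsSubcriticalLevel T Λ ∧ HasCagedTopAt ν T Λ A u

/-- **Slab-caged top**: some subcritical moving level `Λ(t)` and some `A` slab-cage the top. -/
def HasSlabCagedTop (ν T : ℝ) (u : ℝ → E3 → E3) : Prop :=
  ∃ (Λ : ℝ → ℝ) (A : ℝ), IsSubcriticalLevel T Λ ∧ HasSlabCagedTopAt ν T Λ A u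

/-- **Porous top**: some subcritical moving level `Λ(t)` and some `A`, `a > 0` make the top porous. -/
def HasPorousTop (ν T : ℝ) (u : ℝ → E3 → E3) : Prop :=
  ∃ (Λ : ℝ → ℝ) (A a : ℝ), IsSubcriticalLevel T Λ ∧ 0 < a ∧ HasPorousTopAt ν T Λ A a u

/-- Constant levels are subcritical. -/
theorem isSubcriticalLevel_const (T Λ : ℝ) : IsSubcriticalLevel T (fun _ => Λ) := by
  have h : Tendsto (fun t : ℝ => Λ * Real.sqrt (T - t)) (𝓝 T) (𝓝 (Λ * Real.sqrt (T - T))) :=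
    ((continuous_const.sub continuous_id).sqrt.tendsto T).const_mul Λ
  rw [sub_self, Real.sqrt_zero, mul_zero] at h
  exact h.mono_left nhdsWithin_le_nhds

/-- A ball cage is a slab cage (in any fixed unit direction; Cauchy–Schwarz). -/
theorem HasCagedTopAt.hasSlabCagedTopAt {ν T : ℝ} {Λ : ℝ → ℝ} {A : ℝ} {u : ℝ → E3 → E3}
    (h : HasCagedTopAt ν T Λ A u) : HasSlabCagedTopAt ν T Λ A u := by
  have he : ‖(EuclideanSpace.single (0 : Fin 3) (1 : ℝ) : E3)‖ = 1 := by
    rw [PiLp.norm_single, norm_one]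
  filter_upwards [h] with t ht
  refine ⟨EuclideanSpace.single (0 : Fin 3) (1 : ℝ), he, fun x x' hx hx' => ?_⟩
  calc |⟪x - x', EuclideanSpace.single (0 : Fin 3) (1 : ℝ)⟫|
      ≤ ‖x - x'‖ * ‖(EuclideanSpace.single (0 : Fin 3) (1 : ℝ) : E3)‖ := abs_real_inner_le_norm _ _
    _ = ‖x - x'‖ := by rw [he, mul_one]
    _ ≤ A * Real.sqrt (ν * (T - t)) := ht x x' hx hx'

/-- A slab cage is a porous top (the pore sits just beyond the slab: constants `|A| + 1`, `1`). -/
theorem HasSlabCagedTopAt.hasPorousTopAt {ν T : ℝ} {Λ : ℝ → ℝ} {A : ℝ} {u : ℝ → E3 → E3}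
    (h : HasSlabCagedTopAt ν T Λ A u) : HasPorousTopAt ν T Λ (|A| + 1) 1 u := by
  filter_upwards [h] with t ht
  obtain ⟨e, he, hP⟩ := ht
  intro x hx
  set r : ℝ := Real.sqrt (ν * (T - t)) with hr
  have hr0 : 0 ≤ r := Real.sqrt_nonneg _
  refine ⟨x + ((|A| + 1) * r) • e, ?_, fun x' hx' => ?_⟩
  · rw [add_sub_cancel_left, norm_smul, he, mul_one, Real.norm_eq_abs, abs_of_nonneg (by positivity)]
  · by_contra hcon
    push Not at hcon
    have h1 : |⟪x' - x, e⟫| ≤ |A| * r :=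
      (hP x' x hcon hx).trans (mul_le_mul_of_nonneg_right (le_abs_self A) hr0)
    have h2 : ⟪x' - x, e⟫ = ⟪x' - (x + ((|A| + 1) * r) • e), e⟫ + (|A| + 1) * r := by
      rw [show x' - x = (x' - (x + ((|A| + 1) * r) • e)) + ((|A| + 1) * r) • e by abel,
        inner_add_left, real_inner_smul_left, real_inner_self_eq_norm_sq, he]
      ring
    have h3 : -‖x' - (x + ((|A| + 1) * r) • e)‖ ≤ ⟪x' - (x + ((|A| + 1) * r) • e), e⟫ := by
      have h := abs_real_inner_le_norm (x' - (x + ((|A| + 1) * r) • e)) e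
      rw [he, mul_one] at h
      linarith [neg_abs_le ⟪x' - (x + ((|A| + 1) * r) • e), e⟫]
    have h4 : ‖x' - (x + ((|A| + 1) * r) • e)‖ < 1 * r := hx'
    linarith [le_abs_self ⟪x' - x, e⟫]

/-- A caged top is a subcritically caged top. -/
theorem HasCagedTop.hasSubcriticallyCagedTop {ν T : ℝ} {u : ℝ → E3 → E3} (h : HasCagedTop ν T u) :
    HasSubcriticallyCagedTop ν T u := by
  obtain ⟨Λ, A, hA⟩ := h
  exact ⟨fun _ => Λ, A, isSubcriticalLevel_const T Λ, hA⟩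

/-- A subcritically caged top is a slab-caged top. -/
theorem HasSubcriticallyCagedTop.hasSlabCagedTop {ν T : ℝ} {u : ℝ → E3 → E3}
    (h : HasSubcriticallyCagedTop ν T u) : HasSlabCagedTop ν T u := by
  obtain ⟨Λ, A, hΛ, hA⟩ := h
  exact ⟨Λ, A, hΛ, hA.hasSlabCagedTopAt⟩

/-- A slab-caged top is a porous top. -/
theorem HasSlabCagedTop.hasPorousTop {ν T : ℝ} {u : ℝ → E3 → E3} (h : HasSlabCagedTop ν T u) :
    HasPorousTop ν T u := by
  obtain ⟨Λ, A, hΛ, hA⟩ := h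
  exact ⟨Λ, |A| + 1, 1, hΛ, one_pos, hA.hasPorousTopAt⟩

/-- **Criterion row F1cg** (Type I · no symmetry · Clay class · CAGED TOP): the frame of
`ScenarioCensus.Row_F1` verbatim plus `HasCagedTop ν T u` ⇒ extension past `T`.  PROVED (`rowF1cg_holds`). -/
def Row_F1cg : Prop :=
  ∀ (ν T : ℝ), 0 < ν → 0 < T →
    ∀ (u : ℝ → E3 → E3) (p : ℝ → E3 → ℝ),
    IsClassicalNSSolutionOn (Ico 0 T) ν 0 u p → IsLerayHopfOn T ν 0 (u 0) u →
    HasRapidSpatialDecay (u 0) → IsTypeIBlowup u T → HasCagedTop ν T u →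
    HasSmoothExtensionPast ν 0 u T

/-- **Criterion row F1scg** (⊇ F1cg; ball cage at a subcritical moving level): the frame of `Row_F1` verbatim
plus `HasSubcriticallyCagedTop ν T u` ⇒ extension past `T`.  PROVED (`rowF1scg_holds`). -/
def Row_F1scg : Prop :=
  ∀ (ν T : ℝ), 0 < ν → 0 < T →
    ∀ (u : ℝ → E3 → E3) (p : ℝ → E3 → ℝ),
    IsClassicalNSSolutionOn (Ico 0 T) ν 0 u p → IsLerayHopfOn T ν 0 (u 0) u →
    HasRapidSpatialDecay (u 0) → IsTypeIBlowup u T → HasSubcriticallyCagedTop ν T u →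
    HasSmoothExtensionPast ν 0 u T

/-- **Criterion row F1sl** (⊇ F1scg; SLAB cage with time-dependent normal, subcritical moving level): the
frame of `Row_F1` verbatim plus `HasSlabCagedTop ν T u` ⇒ extension past `T`.  PROVED (`rowF1sl_holds`). -/
def Row_F1sl : Prop :=
  ∀ (ν T : ℝ), 0 < ν → 0 < T →
    ∀ (u : ℝ → E3 → E3) (p : ℝ → E3 → ℝ),
    IsClassicalNSSolutionOn (Ico 0 T) ν 0 u p → IsLerayHopfOn T ν 0 (u 0) u →
    HasRapidSpatialDecay (u 0) → IsTypeIBlowup u T → HasSlabCagedTop ν T u →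
    HasSmoothExtensionPast ν 0 u T

/-- **Criterion row F1po** (⊇ F1sl; POROUS top, subcritical moving level — the master row of the line): the
frame of `Row_F1` verbatim plus `HasPorousTop ν T u` ⇒ extension past `T`.  PROVED (`rowF1po_holds`). -/
def Row_F1po : Prop :=
  ∀ (ν T : ℝ), 0 < ν → 0 < T →
    ∀ (u : ℝ → E3 → E3) (p : ℝ → E3 → ℝ),
    IsClassicalNSSolutionOn (Ico 0 T) ν 0 u p → IsLerayHopfOn T ν 0 (u 0) u →
    HasRapidSpatialDecay (u 0) → IsTypeIBlowup u T → HasPorousTop ν T u →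
    HasSmoothExtensionPast ν 0 u T

/-- **Structural floor «SOLID TOP»** (maximal frame): a Type-I Clay blow-up has NO porous top — at every
subcritical level and all parabolic scales `A`, `a > 0`, arbitrarily close to `T` some fast point has NO
fast-free pore of radius `a √(ν (T − t))` within distance `A √(ν (T − t))`: the top is parabolically solid at
every scale.  PROVED (`solidTop_holds`). -/
def SolidTop : Prop :=
  ∀ (ν T : ℝ), 0 < ν → 0 < T →
    ∀ (u : ℝ → E3 → E3) (p : ℝ → E3 → ℝ),
    IsMaximalSmoothSolution ν 0 u p T → IsLerayHopfOn T ν 0 (u 0) u →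
    HasRapidSpatialDecay (u 0) → IsTypeIBlowup u T → ¬ HasPorousTop ν T u

/-- **Residual** (maximal frame): every Type-I Clay blow-up has a caged top.  DECLARED ≡ row F1
(`topCaging_iff_rowF1`); zero movement on `Row_F1` is claimed. -/
@[conjecture] def TopCaging : Prop :=
  ∀ (ν T : ℝ), 0 < ν → 0 < T →
    ∀ (u : ℝ → E3 → E3) (p : ℝ → E3 → ℝ),
    IsMaximalSmoothSolution ν 0 u p T → IsLerayHopfOn T ν 0 (u 0) u →
    HasRapidSpatialDecay (u 0) → IsTypeIBlowup u T → HasCagedTop ν T u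

/-- F1scg contains F1cg. -/
theorem rowF1cg_of_rowF1scg (h : Row_F1scg) : Row_F1cg :=
  fun ν T hν hT u p hsol hLH hdec hTI hcg => h ν T hν hT u p hsol hLH hdec hTI hcg.hasSubcriticallyCagedTop

/-- F1sl contains F1scg. -/
theorem rowF1scg_of_rowF1sl (h : Row_F1sl) : Row_F1scg :=
  fun ν T hν hT u p hsol hLH hdec hTI hcg => h ν T hν hT u p hsol hLH hdec hTI hcg.hasSlabCagedTop

/-- F1po contains F1sl. -/
theorem rowF1sl_of_rowF1po (h : Row_F1po) : Row_F1sl :=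
  fun ν T hν hT u p hsol hLH hdec hTI hcg => h ν T hν hT u p hsol hLH hdec hTI hcg.hasPorousTop

/-- **The split**: criterion + residual ⇒ row F1 (by cases on extendability). -/
theorem rowF1_of (hD : Row_F1cg) (hTC : TopCaging) : ScenarioCensus.Row_F1 := by
  unfold ScenarioCensus.Row_F1
  intro ν T hν hT u p hsol hLH hdec hTI
  by_contra hext
  exact hext (hD ν T hν hT u p hsol hLH hdec hTI (hTC ν T hν hT u p ⟨hsol, hext⟩ hLH hdec hTI))

/-- The residual is a consequence of the row (vacuously: under `Row_F1` no maximal solution is Type I). -/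
theorem topCaging_of_rowF1 (h : ScenarioCensus.Row_F1) : TopCaging :=
  fun ν T hν hT u p hmax hLH hdec hTI => (hmax.2 (h ν T hν hT u p hmax.1 hLH hdec hTI)).elim

/-! ## §2 Analytic slices of `𝒦_C`; the singular Type-I zoom package -/

/-- Slices `W t`, `t < 0`, of an element of `𝒦_C` (`IsTypeIAncientMild C W`) are real-analytic on `ℝ³`
(tree: `analyticOnNhd_slice`, Lemarié-Rieusset 2016 Thm 9.12 + bounded-mild uniqueness, via the Type-I
bound on sub-slabs and the Oseen identity with `heatFlow = heatExtension` for positive times). -/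
theorem analyticOnNhd_of_isTypeIAncientMild {C : ℝ} {W : ℝ → E3 → E3} (hW : IsTypeIAncientMild C W)
    {t : ℝ} (ht : t < 0) : AnalyticOnNhd ℝ (W t) univ := by
  refine analyticOnNhd_slice hW.1.continuousOn (bdd_of_hasTypeITimeDecay hW.2.2.2)
    (fun s t hst ht y => ?_) ht
  rw [hW.2.2.1 s t hst ht y, heatFlow_of_pos _ (sub_pos.2 hst)]

/-- **Identity theorem for slices of `𝒦_C`**: a slice vanishing on a ball vanishes identically. -/
theorem slice_eq_zero_of_eqOn_ball {C : ℝ} {W : ℝ → E3 → E3} (hW : IsTypeIAncientMild C W)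
    {t : ℝ} (ht : t < 0) {z : E3} {ρ : ℝ} (hρ : 0 < ρ) (hz : ∀ y ∈ ball z ρ, W t y = 0) :
    ∀ y, W t y = 0 := by
  have hev : W t =ᶠ[𝓝 z] 0 := eventually_of_mem (ball_mem_nhds z hρ) fun y hy => hz y hy
  have key := (analyticOnNhd_of_isTypeIAncientMild hW ht).eqOn_zero_of_preconnected_of_eventuallyEq_zero
    isPreconnected_univ (mem_univ z) hev
  exact fun y => key (mem_univ y)

/-- **The singular Type-I zoom package** at a backward-singular final-time point `(T, x₀)` of a Type-I Clay
solution: positive constants `α, β, R`, positive scales `c_j → 0` and a NONTRIVIAL element `W ∈ 𝒦_C` such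
that the viscosity-normalising zooms `(c_j α) u(T + c_j² β t, x₀ + c_j R y)` converge to `W(t, y)` at every
point of the open past.  Steps (1)–(4) and (6) of the tree's `singularZoom_zoomLimit` /
`OneWayTop.exists_axial_zoomLimit` verbatim (rate window, Morrey bound, unit zoom, scales `1/(k+4)`,
`C¹_loc` extraction, unboundedness at the origin), packaged for transfer arguments.
(refs: AlbrittonBarker2019, §3; KochNadirashviliSereginSverak2009, Lemma 6.1 (arXiv p. 11)) -/
theorem exists_singularZoom_package {ν T : ℝ} (hν : 0 < ν) (hT : 0 < T)
    {u : ℝ → E3 → E3} {p : ℝ → E3 → ℝ}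
    (hsol : IsClassicalNSSolutionOn (Ico 0 T) ν 0 u p) (hLH : IsLerayHopfOn T ν 0 (u 0) u)
    (hdec : HasRapidSpatialDecay (u 0)) (hTI : IsTypeIBlowup u T) (x₀ : E3)
    (hsing : ∀ r : ℝ, 0 < r →
      eLpNorm (uncurry u) ∞ (volume.restrict (parabolicCylinder r ((T : ℝ), x₀))) = ∞) :
    ∃ (C α β R : ℝ) (c : ℕ → ℝ) (W : ℝ → E3 → E3),
      0 < α ∧ 0 < β ∧ 0 < R ∧ (∀ j, 0 < c j) ∧ Tendsto c atTop (𝓝 0) ∧ IsTypeIAncientMild C W ∧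
      (∀ t < 0, ∀ y : E3,
        Tendsto (fun j => (c j * α) • u (T + c j ^ 2 * β * t) (x₀ + (c j * R) • y)) atTop (𝓝 (W t y))) ∧
      ∃ t < 0, ∃ y, W t y ≠ 0 := by
  -- ## (1) the Type-I rate window, the Morrey bound and the unit zoom at `(T, x₀)`
  obtain ⟨C, δ, -, hδ, hδT, hrate⟩ := exists_typeI_rate_window hT hTI
  obtain ⟨r₀, M₀, T₁, hr₀, hT₁, hMor⟩ := morrey_of_typeI hν hT hsol hLH hTI
  obtain ⟨R, α, β, hR, hα, hβ, hβeq, hαeq, hβT, hball, hGv, htypeI⟩ :=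
    exists_zoom_typeIBound_lt_top_of_morrey hν hT hsol hLH hr₀ hT₁ hMor x₀
  set v : ℝ → E3 → E3 := α • stPull β R T x₀ u with hv
  set πv : ℝ → E3 → ℝ :=
    α ^ 2 • stPull β R T x₀ (fun t x => p t x - (p t 0 - normalisedPressure (u t) 0)) with hπv
  set Gv : ℝ → E3 → E3 →L[ℝ] E3 :=
    (α * R) • stPull β R T x₀ (fun t x => fderiv ℝ (u t) x) with hGvdef
  set I₀ : ℝ≥0∞ := typeIBound (parabolicCylinder (1 / 2) (0 : ℝ × E3)) v πv Gv with hI₀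
  have hI₀top : I₀ ≠ ⊤ := htypeI.ne
  -- ## (2) the scales `c k = 1/(k+4) ↓ 0` and the zoom sequence
  set c : ℕ → ℝ := fun k => 1 / ((k : ℝ) + 4) with hc
  have hcpos : ∀ k, 0 < c k := fun k => by simp only [hc]; positivity
  have hc4 : ∀ k, c k ≤ 1 / 4 := fun k =>
    div_le_div_of_nonneg_left zero_le_one (by norm_num) (by linarith [(Nat.cast_nonneg k : (0 : ℝ) ≤ k)])
  have hc2 : ∀ k, c k ≤ 1 / 2 := fun k => (hc4 k).trans (by norm_num)
  have hclim : Tendsto c atTop (𝓝 0) :=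
    tendsto_const_nhds.div_atTop (tendsto_atTop_add_const_right _ _ tendsto_natCast_atTop_atTop)
  set w : ℕ → ℝ → E3 → E3 :=
    fun k => (c k * α) • stPull (c k ^ 2 * β) (c k * R) T x₀ u with hw
  -- the final windows `(Aw k, 0)`, `Aw k → -∞`
  set Aw : ℕ → ℝ := fun k => -(δ / (c k ^ 2 * β)) with hA
  have hAk : ∀ k, Aw k = -(δ / β * ((k : ℝ) + 4) ^ 2) := by
    intro k
    simp only [hA, hc]
    field_simp
  have hAlim : Tendsto Aw atTop atBot := by
    have h1 : Tendsto (fun k : ℕ => ((k : ℝ) + 4) ^ 2) atTop atTop :=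
      (tendsto_pow_atTop two_ne_zero).comp
        (tendsto_atTop_add_const_right _ _ tendsto_natCast_atTop_atTop)
    have h2 : Tendsto (fun k : ℕ => δ / β * ((k : ℝ) + 4) ^ 2) atTop atTop :=
      h1.const_mul_atTop (by positivity)
    refine (tendsto_neg_atTop_atBot.comp h2).congr fun k => ?_
    rw [hAk k]
    rfl
  -- ## (3) per-scale facts
  have hcW : ∀ k, ContinuousOn (uncurry (w k)) (Ioo (Aw k) 0 ×ˢ univ) := fun k =>
    zoom_continuousOn hν hsol hR hαeq hβeq (hcpos k) hδT
  have hdivW : ∀ k, ∀ t ∈ Ioo (Aw k) 0, IsWeaklyDivFree (w k t) := fun k t ht =>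
    zoom_isWeaklyDivFree hν hsol hR hαeq hβeq (hcpos k) hδT ht
  have hmildW : ∀ k, ∀ s t : ℝ, Aw k < s → s < t → t < 0 → ∀ y,
      w k t y = UnboundedOperators.heatExtension (w k s) (t - s) y -
        oseenDuhamel 1 s (w k) (w k) t y := fun k s t hs hst ht y =>
    zoom_oseen hν hT hsol hLH hdec hR hαeq hβeq (hcpos k) hδT hs hst ht y
  set C₁ : ℝ := α * C / Real.sqrt β with hC₁
  have hIW : ∀ k, ∀ t ∈ Ioo (Aw k) 0, ∀ y, ‖w k t y‖ ≤ C₁ / Real.sqrt (-t) := fun k t ht y =>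
    zoom_norm_le hR hαeq hβeq hν (hcpos k) hδT hrate ht y
  -- ## (4) extraction of the `C¹_loc` limit `W ∈ 𝒦_{C₁}`
  obtain ⟨φ, hφ, W, hWclass, hpt, -, -, -⟩ :=
    exists_tendsto_of_typeI_seq_Ioo C₁ hAlim hcW hdivW hmildW hIW
  have hφt : Tendsto φ atTop atTop := hφ.tendsto_atTop
  have hcφ : Tendsto (fun j => c (φ j)) atTop (𝓝 0) := hclim.comp hφt
  -- ## (6) `W` is unbounded at the origin
  have hsingW : ∀ r > 0, ∀ M : ℝ, ∃ t ∈ Ioo (-(r ^ 2)) (0 : ℝ),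
      ∃ x ∈ ball (0 : E3) r, M < ‖W t x‖ :=
    zoomSeq_unbounded_at_origin (πv := πv) hsol hR hα hβ hβT hsing hball hGv hI₀top
      (fun j => hcpos (φ j)) (fun j => hc2 (φ j)) fun z hz =>
        hpt z.1 ((SuitableCompactness.mem_parabolicCylinder_zero.1 hz).1.2) z.2
  have hwu : ∀ (j : ℕ) (t : ℝ) (y : E3),
      w (φ j) t y = (c (φ j) * α) • u (T + c (φ j) ^ 2 * β * t) (x₀ + (c (φ j) * R) • y) :=
    fun j t y => by simp only [hw, smul_stPull_apply]
  -- ## (7) package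
  obtain ⟨ts, hts, xs, -, hM⟩ := hsingW 1 one_pos 0
  have hne : W ts xs ≠ 0 := by
    intro h0; rw [h0, norm_zero] at hM; exact lt_irrefl _ hM
  exact ⟨C₁, α, β, R, fun j => c (φ j), W, hα, hβ, hR, fun j => hcpos _, hcφ, hWclass,
    fun t ht y => (hpt t ht y).congr fun j => hwu j t y, ts, hts.2, xs, hne⟩

end Summit.NavierStokesRegularity.NavierStokesRegularity.Theorems.ScenarioCensus.CagedTop

end
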